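import Literature.Topology.FourManifolds.ChartCircleTrace
import HarnessLib

/-!
# The trace of the surgery along ANY framed circle tube: an elementary cobordism of index `2`

Topic `Literature/Topology/FourManifolds` (fact seat of
`Literature.Topology.FourManifolds.isHCobordant_of_equivalent_intersectionForm`, Wall 1964 Thm. 2).
`ChartCircleTrace.lean` packages the trace of the surgery along the STANDARD framed circle of a
chart `C : StdChart X` (tube `C.nbhd`) — an elementary cobordism of index `2` from `X` to
`X # S² × S²` (Kirby 1989, Ch. X p. 55).  Everything there except the identification of the top end
as a connected sum is generic in the tube, and this file records it for an ARBITRARY framed tube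
`ν : CircleNbhd (𝓡 4) c` of a closed smooth 4-manifold `X` — in particular for the TWISTED tube
`C.nbhd.linTwist OpLoop.twist`, whose surgery is `X # S² ×~ S²` with an odd intersection form
(Kirby 1989, Ch. VIII p. 50; the tree's `isOdd_intersectionForm_of_isOpenGluingWith_twist`), the
odd core-free model of Wall's trick for odd forms:

* `CircleNbhd.framedFamily`, `CircleNbhd.Top`, `CircleNbhd.trace` — the tube as a one-sphere framed
  family, the top end `χ(X, φ)` and the trace `ω(X, φ)` (Milnor 1965, Thm. 3.12);
* `CircleNbhd.isOpenGluingWith_top` — the top end is the circle surgery of `X` along `ν`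
  (gluing maps `topA'`, `topB'`);
* `CircleNbhd.simplyConnectedSpace_top`, `CircleNbhd.isElementary_trace`,
  `CircleNbhd.simplyConnectedSpace_trace`, `CircleNbhd.epi_map_inr_trace_two`.

The proofs are those of `ChartCircleTrace.lean` verbatim.  Everything is proved; no named fact
(D-0026).

## References

* J. Milnor, *Lectures on the h-cobordism theorem* (1965), Def. 3.10–3.12, Thm. 3.12, Cor. 3.15
  (PDF pp. 16–21). [MilnorHCobordism1965]
* R. C. Kirby, *The topology of 4-manifolds*, LNM 1374 (1989), Ch. VIII p. 50, Ch. X pp. 55–56.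
  [Kirby1989]
-/

noncomputable section

open scoped Manifold ContDiff Topology
open Set Function CategoryTheory
open Literature.AlgebraicTopology.SingularHomology

namespace Literature.Topology.FourManifolds

/-- Local notation: `𝔼 n` is the model Euclidean space `EuclideanSpace ℝ (Fin n)`. -/
local notation "𝔼 " n:arg => EuclideanSpace ℝ (Fin n)
/-- Local notation: `𝕊 n` is the unit sphere in `EuclideanSpace ℝ (Fin (n + 1))`. -/
local notation "𝕊 " n:arg => (Metric.sphere (0 : EuclideanSpace ℝ (Fin (n + 1))) 1)

namespace CircleNbhd

open StdCircleSurgery SurgeryTrace MilnorTrace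

variable {X : Type} [TopologicalSpace X] [ChartedSpace (𝔼 4) X] [T2Space X] [IsManifold (𝓡 4) ∞ X]
  {c : 𝕊 1 → X} (ν : CircleNbhd (𝓡 4) c)

/-! ### The tube as a one-sphere framed family, and its trace -/

/-- **The framed tube as a framed family with one sphere** (`S¹ × ℝ³ ↪ X`).
[cite: Kirby1989, Ch. X, proof of Thm. 1, p. 55] -/
def framedFamily : FramedSphereFamily (𝓡 4) X Unit 1 3 where
  toFun _ := ν.toFun
  isSmoothEmbedding _ := ν.isSmoothEmbedding
  isOpen_range _ := ν.isOpen_range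
  disjoint_range i j h := (h (Subsingleton.elim i j)).elim

omit [T2Space X] [IsManifold (𝓡 4) ∞ X] in
/-- The tube of the framed family is the given tube. [folklore] -/
@[simp] theorem framedFamily_toFun (i : Unit) : ν.framedFamily.toFun i = ν.toFun := rfl

omit [T2Space X] [IsManifold (𝓡 4) ∞ X] in
/-- The core of the framed family is the circle `c`. [folklore] -/
theorem cores_framedFamily : ν.framedFamily.cores = range c := by
  ext x
  rw [FramedSphereFamily.mem_cores_iff]
  constructor
  · rintro ⟨i, v, rfl⟩
    exact ⟨v, (ν.apply_zero v).symm⟩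
  · rintro ⟨v, rfl⟩
    exact ⟨(), v, ν.apply_zero v⟩

omit [IsManifold (𝓡 4) ∞ X] in
/-- The complement of the core of the framed family is the complement of the circle. [folklore] -/
theorem mem_complement_framedFamily_iff (x : X) : x ∈ ν.framedFamily.complement ↔ x ∈ ν.complement := by
  rw [FramedSphereFamily.mem_complement_iff, CircleNbhd.mem_complement_iff, cores_framedFamily]

/-! ### The top end is the circle surgery of `X` along the tube of the chart -/

/-- **The top end `χ(X, φ)` of the trace** (a closed smooth 4-manifold). [cite: MilnorHCobordism1965, Thm. 3.12 (PDF pp. 17–19)] -/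
abbrev Top : Type := ↥(topEnd ν.framedFamily StdChart.hkl)


omit [IsManifold (𝓡 4) ∞ X] in
/-- The identification of the two complements (equal open subsets of `X`). [folklore] -/
theorem exists_complDiffeo : ∃ ψ : ↥ν.complement ≃ₘ⟮𝓡 4, 𝓡 4⟯ ↥ν.framedFamily.complement,
    ∀ x, (ψ x : X) = x :=
  exists_diffeomorph_opens (Diffeomorph.refl (𝓡 4) X ∞) ν.complement ν.framedFamily.complement
    (fun x => by rw [Diffeomorph.coe_refl, id, mem_complement_framedFamily_iff])

/-- The identification of the two complements, `X ∖ c ≅ X ∖ cores`. [folklore] -/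
def complDiffeo : ↥ν.complement ≃ₘ⟮𝓡 4, 𝓡 4⟯ ↥ν.framedFamily.complement :=
  Classical.choose ν.exists_complDiffeo

omit [IsManifold (𝓡 4) ∞ X] in
/-- `complDiffeo` is the identity on points. [folklore] -/
@[simp] theorem coe_complDiffeo (x : ↥ν.complement) : (ν.complDiffeo x : X) = x :=
  Classical.choose_spec ν.exists_complDiffeo x



/-- **The first gluing map of the top end in the circle-surgery language**: `topA` after the
identification of the complements. [cite: MilnorHCobordism1965, Thm. 3.12 (PDF pp. 17–19)] -/
def topA' (a : ↥ν.complement) : ν.Top := topA ν.framedFamily StdChart.hkl (ν.complDiffeo a)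

/-- **The second gluing map of the top end in the circle-surgery language**: `topB` after
re-indexing the new piece. [cite: MilnorHCobordism1965, Thm. 3.12 (PDF pp. 17–19)] -/
def topB' (b : ↥discTimesSphere) : ν.Top := topB ν.framedFamily StdChart.hkl (StdChart.ballDiffeo b)

/-- `topA'` unfolds to `topA`. [folklore] -/
theorem topA'_apply (a : ↥ν.complement) : ν.topA' a = topA ν.framedFamily StdChart.hkl (ν.complDiffeo a) := rfl

/-- `topB'` unfolds to `topB`. [folklore] -/
theorem topB'_apply (b : ↥discTimesSphere) : ν.topB' b = topB ν.framedFamily StdChart.hkl (StdChart.ballDiffeo b) := rfl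

omit [IsManifold (𝓡 4) ∞ X] in
/-- The family surgery relation, re-indexed, is the circle surgery relation of the tube. [folklore] -/
theorem sphereFamilySurgeryRel_iff (a : ↥ν.complement) (b : ↥discTimesSphere) :
    sphereFamilySurgeryRel ν.framedFamily (ν.complDiffeo a) (StdChart.ballDiffeo b) ↔ circleSurgeryRel ν a b := by
  simp only [sphereFamilySurgeryRel, circleSurgeryRel, StdChart.coe_ballDiffeo, framedFamily_toFun, coe_complDiffeo]

/-- `topB'` as a globally defined partial diffeomorphism onto an open subset of the top end. [folklore] -/
def topB'Homeo : OpenPartialHomeomorph ↥discTimesSphere ν.Top :=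
  StdChart.ballDiffeo.toHomeomorph.toOpenPartialHomeomorph.trans (topBHomeo ν.framedFamily StdChart.hkl)

/-- `topB'Homeo` acts as `topB'`. [folklore] -/
theorem topB'Homeo_apply (b : ↥discTimesSphere) : ν.topB'Homeo b = ν.topB' b := rfl

/-- `topB'` is a smooth embedding (a globally defined partial diffeomorphism; the model vector spaces
`ℝ² × ℝ²` and `ℝ⁴` have the same dimension). [folklore] -/
theorem isSmoothEmbedding_topB' : Manifold.IsSmoothEmbedding (𝓘(ℝ, 𝔼 2).prod (𝓡 2)) (𝓡 4) ∞ ν.topB' := by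
  have hsrc : ν.topB'Homeo.source = univ := by
    simp [topB'Homeo, topBHomeo]
  have h1 : ContMDiffOn (𝓘(ℝ, 𝔼 2).prod (𝓡 2)) (𝓡 4) ∞ ν.topB'Homeo ν.topB'Homeo.source := by
    intro b _
    exact ((contMDiff_topB ν.framedFamily StdChart.hkl).comp StdChart.ballDiffeo.contMDiff b).contMDiffWithinAt
  have h2 : ContMDiffOn (𝓡 4) (𝓘(ℝ, 𝔼 2).prod (𝓡 2)) ∞ ν.topB'Homeo.symm ν.topB'Homeo.target := by
    rintro y hy
    have hy' : y ∈ (topBHomeo ν.framedFamily StdChart.hkl).target := by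
      simpa [topB'Homeo] using hy
    obtain ⟨b, hb⟩ := hy'
    have h3 : ContMDiffAt (𝓡 4) (SphereSurgery.handleModelWithCorners 1 2) ∞ (topBInv ν.framedFamily StdChart.hkl) y :=
      contMDiffAt_topBInv ν.framedFamily StdChart.hkl hb
    exact (StdChart.ballDiffeo.symm.contMDiff.contMDiffAt.comp y h3).contMDiffWithinAt
  have h := isSmoothEmbedding_of_openPartialHomeomorph (I := 𝓘(ℝ, 𝔼 2).prod (𝓡 2)) (J := 𝓡 4) (n := ∞)
    ν.topB'Homeo hsrc h1 h2 (ContinuousLinearEquiv.ofFinrankEq (by simp))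
  exact h

/-- **The top end of the trace is the circle surgery of `X` along the tube of the chart**, with the
explicit gluing maps `topA'`, `topB'` (`SurgeryTrace.isOpenGluingWith_topEnd`, re-indexed).
[cite: MilnorHCobordism1965, Def. 3.11, Thm. 3.12 (PDF pp. 17–19)] -/
theorem isOpenGluingWith_top :
    IsOpenGluingWith (𝓡 4) (𝓘(ℝ, 𝔼 2).prod (𝓡 2)) (𝓡 4) (A := ↥ν.complement) (B := ↥discTimesSphere)
      (P := ν.Top) (circleSurgeryRel ν) ν.topA' ν.topB' := by
  obtain ⟨hA, hAo, hB, hBo, hU, hR⟩ := isOpenGluingWith_topEnd ν.framedFamily StdChart.hkl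
  have hrA : range ν.topA' = range (topA ν.framedFamily StdChart.hkl) := ν.complDiffeo.surjective.range_comp _
  have hrB : range ν.topB' = range (topB ν.framedFamily StdChart.hkl) := StdChart.ballDiffeo.surjective.range_comp _
  refine ⟨hA.comp_diffeomorph ν.complDiffeo, hrA ▸ hAo, ν.isSmoothEmbedding_topB', hrB ▸ hBo,
    by rw [hrA, hrB, hU], fun a b => ?_⟩
  rw [topA'_apply, topB'_apply, hR, sphereFamilySurgeryRel_iff]

/-- **The top end is simply connected if `X` is** (van Kampen for the surgery of index `2` with
cosphere `S²`, `SphereSurgeryPi1.lean`). [cite: Kirby1989, Ch. X p. 56] -/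
theorem simplyConnectedSpace_top [SimplyConnectedSpace X] : SimplyConnectedSpace ν.Top := by
  obtain ⟨hA, hAo, hB, hBo, hU, hR⟩ := isOpenGluingWith_topEnd ν.framedFamily StdChart.hkl
  exact FramedSphereFamily.simplyConnectedSpace_of_surgery ⟨hA.isEmbedding, hAo⟩ ⟨hB.isEmbedding, hBo⟩ hU hR
    le_rfl le_rfl


variable [CompactSpace X]

/-- **The trace of the surgery along the standard framed circle of the chart**
(`ω(X, φ)`, Milnor 1965, Thm. 3.12), a cobordism from `X` to the surgered manifold. [cite: MilnorHCobordism1965, Thm. 3.12 (PDF pp. 17–19)] -/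
abbrev trace : Cobordism (3 + 1) X ↥(topEnd ν.framedFamily StdChart.hkl) := traceCobordism ν.framedFamily StdChart.hkl

/-- **The trace is an elementary cobordism of index `2`** (`TraceMorseFunction.lean`). [cite: MilnorHCobordism1965, Def. 3.10, Thm. 3.12] -/
theorem isElementary_trace : ν.trace.IsElementary 2 := isElementary_traceCobordism ν.framedFamily StdChart.hkl

/-- **The trace is simply connected if `X` is** (index `2 ≥ 2`; `ElementaryCobordismTopology.lean`).
[cite: Kirby1989, Ch. X p. 56 ("everything is simply connected")] -/
theorem simplyConnectedSpace_trace [SecondCountableTopology X] [SimplyConnectedSpace X] :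
    SimplyConnectedSpace ν.trace.W :=
  ν.isElementary_trace.simplyConnectedSpace_of_two_le le_rfl

/-- **`H₂(χ) → H₂(ω)` is onto** for the trace (`2 + 2 ≠ 5`: turned about, the trace is elementary of
index `3`, so `H₂(ω, χ) = 0`). [cite: Kirby1989, Ch. X p. 56 ("cancel homologically")] [cite: MilnorHCobordism1965, Cor. 3.15] -/
theorem epi_map_inr_trace_two [SecondCountableTopology X] :
    Epi (singularHomology.map ℤ ℤ (⟨ν.trace.inr, ν.trace.continuous_inr⟩ : C(ν.Top, ν.trace.W)) 2) :=
  ν.isElementary_trace.epi_map_inr (by norm_num)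

end CircleNbhd

end Literature.Topology.FourManifolds

end
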